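import Summits.Parity.GeneralizedHardyLittlewood.Theorems.PrimeLevelFamEdgeMomentsBeyondDiagonalDiagRemOneSidedMoments
import HarnessLib

/-!
# Route `PrimeLevelFamEdge`, crux K_A `MomentsBeyondDiagonal` (stmt-Parity-20007), line «petersson_layers» v4, stub `stub_diag`:
# **the generic one-sided and both-sided moment monomials, PARAMETRIC in the tail constants** (so that ONE set of constants serves all kernels
# of a remainder weight table — the form consumed by the family bounds `h0 … hDD` of `…DiagRemFourFourMonomials.abs_monomial_weight_le₄₄`)

`…DiagRemBothSidedMoments.abs_bothsided_moments_le_pow` and `…DiagRemOneSidedMoments.abs_onesided_moments_le_pow` package the tail constants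
existentially per kernel; the family hypotheses of the monomial bookkeeping quantify over a LIST of kernels with one envelope. Here the same
two proofs with the constants of «DRTAIL»_r (`…DiagRemMomentTailBoundPow.abs_sum_Wn_logDiff_pow_sub_le_pow`) and of the row saving
(`…DiagRemLogSavingPow.abs_sum_copTauW_le_pow`) taken as INPUTS:

* `abs_bothsided_moments_le_pow_of` — `(W_nS_r) ⊗ (W_nS_s) · R` given `C₁, C₂`;
* `abs_onesided_moments_le_pow_of` — `a_n ⊗ (W_nS_s) · R` given `C_a, C₂`.

Def-free; theorems only. Helper `--supports stmt-Parity-20007`; closes nothing; K_A, K_B and the Parity summit are NOT proved;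
nothing about Landau–Siegel zeros.

## References
* E. Kowalski, P. Michel, J. VanderKam, J. reine angew. Math. 526 (2000), Prop. 5.1 p. 18.
  [cite: KowalskiMichelVanderKam2000, Prop. 5.1 — derivation (decorated remainder monomials, any order)]
-/

noncomputable section

open Real Finset

namespace Summit.Parity.GeneralizedHardyLittlewood.Theorems.MomentsBeyondDiagonal.DiagCorner

open Literature.NumberTheory.LFunctions.KMV2000.MollifierMainTerm (W)
open Summit.Parity.GeneralizedHardyLittlewood.Theorems.BeyondDiagonalBeatsQuarter.KernelFormXSq
  (copTauW divWeight divWeight_nonneg one_le_divWeight abs_W_le)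
open Summit.Parity.GeneralizedHardyLittlewood.Theorems.BeyondDiagonalBeatsQuarter.Corner

set_option maxHeartbeats 3200000 in
/-- **The generic both-sided moment monomial, PARAMETRIC form**: the tail constants `C₁, C₂` of «DRTAIL»_r, «DRTAIL»_s are inputs (so
that one pair serves every kernel of a weight table). [cite: KowalskiMichelVanderKam2000, Prop. 5.1 — derivation (both-sided decorated remainder monomial)] -/
theorem abs_bothsided_moments_le_pow_of (r s A : ℕ) {C₁ C₂ : ℝ} (hC₁ : 0 ≤ C₁) (hC₂ : 0 ≤ C₂)
    (h₁ : ∀ n : ℕ, n ≠ 0 → ∃ c : ℝ, |c| ≤ C₁ * divWeight n ∧ ∀ y : ℝ, 1 ≤ y →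
      |(∑ k ∈ Icc 1 ⌊y⌋₊, (if k.Coprime n then W k else 0) *
          ∑ z ∈ k.divisorsAntidiagonal, (Real.log z.1 - Real.log z.2) ^ r) - c| ≤ C₁ * divWeight n / (1 + Real.log y) ^ A)
    (h₂ : ∀ n : ℕ, n ≠ 0 → ∃ c : ℝ, |c| ≤ C₂ * divWeight n ∧ ∀ y : ℝ, 1 ≤ y →
      |(∑ k ∈ Icc 1 ⌊y⌋₊, (if k.Coprime n then W k else 0) *
          ∑ z ∈ k.divisorsAntidiagonal, (Real.log z.1 - Real.log z.2) ^ s) - c| ≤ C₂ * divWeight n / (1 + Real.log y) ^ A)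
    {N M : ℕ} (hMN : M ≤ N) {R : ℝ → ℝ} {C₀ : ℝ} (hC₀ : 0 ≤ C₀)
    (hR2 : ∀ (a₁ a₂ : ℕ → ℝ) (Y α B η : ℝ) (K₁ i j : ℕ), 1 ≤ Y → 0 < α → 1 ≤ i → 1 ≤ j →
      (∀ e : ℕ, e ≤ ⌊Y⌋₊ → |∑ k ∈ Icc 1 e, a₂ k| ≤ B) → (∀ e : ℕ, K₁ ≤ e → |∑ k ∈ Icc 1 e, a₁ k| ≤ η) →
      2 * α * K₁ * Y ≤ 1 →
    |∑ k₁ ∈ Icc 1 ⌊Y⌋₊, ∑ k₂ ∈ Icc 1 ⌊Y⌋₊,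
        a₁ k₁ * a₂ k₂ * ellp Y k₁ ^ i * ellp Y k₂ ^ j * R (α * k₁ * k₂)| ≤
      (∑ k ∈ Icc 1 ⌊Y⌋₊, |a₁ k| * ellp Y k ^ i) * (B * (Real.log Y ^ j * (3 * C₀ * Real.sqrt (2 * α * K₁ * Y)))) +
        (∑ k ∈ Icc 1 ⌊Y⌋₊, |a₂ k| * ellp Y k ^ j) *
          ((2 * η) * (Real.log Y ^ i * (9 * C₀ * (1 + |Real.log (2 * α * Y ^ 2)|) ^ N))))
    (hRs : ∀ y : ℝ, 0 < y → y ≤ 1 → |R y| ≤ C₀ * Real.sqrt y)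
    (hRt : ∀ y : ℝ, 1 ≤ y → |R y| ≤ C₀ * (1 + Real.log y) ^ M) :
    ∀ n : ℕ, n ≠ 0 → ∀ (Y α : ℝ) (K₁ i j : ℕ), 1 ≤ Y → 0 < α → 1 ≤ i → 1 ≤ j → 2 * α * K₁ * Y ≤ 1 →
    |∑ k₁ ∈ Icc 1 ⌊Y⌋₊, ∑ k₂ ∈ Icc 1 ⌊Y⌋₊,
        ((if k₁.Coprime n then W k₁ else 0) * ∑ x ∈ k₁.divisorsAntidiagonal, (Real.log x.1 - Real.log x.2) ^ r) *
          ((if k₂.Coprime n then W k₂ else 0) * ∑ x ∈ k₂.divisorsAntidiagonal, (Real.log x.1 - Real.log x.2) ^ s) *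
            ellp Y k₁ ^ i * ellp Y k₂ ^ j * R (α * k₁ * k₂)| ≤
      Real.log Y ^ (i + j) * (C₀ *
        ((6 * (C₂ * divWeight n) * ((1 + Real.log Y) ^ (r + 2) + C₁ * divWeight n) +
            3 * (C₁ * divWeight n) * ((1 + Real.log Y) ^ (s + 2) + C₂ * divWeight n) +
              (C₁ * divWeight n) * (C₂ * divWeight n)) * Real.sqrt (2 * α * K₁ * Y) +
          (18 * (1 + Real.log Y) ^ (s + 2) * (C₁ * divWeight n) + 19 * ((C₁ * divWeight n) * (C₂ * divWeight n))) *
            (1 + |Real.log (2 * α * Y ^ 2)|) ^ N / (1 + Real.log K₁) ^ A)) := by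
  intro n hn Y α K₁ i j hY hα hi hj hY₁
  obtain ⟨c₁, hc₁, hc₁y⟩ := h₁ n hn
  obtain ⟨c₂, hc₂, hc₂y⟩ := h₂ n hn
  set D : ℝ := divWeight n with hDdef
  have hD0 : 0 ≤ D := divWeight_nonneg n
  have hY0 : 0 < Y := by linarith
  have hLY : 0 ≤ Real.log Y := Real.log_nonneg hY
  set L₁ : ℝ := (1 + Real.log Y) ^ (r + 2) with hL₁
  set L₂ : ℝ := (1 + Real.log Y) ^ (s + 2) with hL₂
  have hL₁0 : 0 ≤ L₁ := by positivity
  have hL₂0 : 0 ≤ L₂ := by positivity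
  set x : ℝ := 1 + |Real.log (2 * α * Y ^ 2)| with hx
  have hx1 : 1 ≤ x := by rw [hx]; linarith [abs_nonneg (Real.log (2 * α * Y ^ 2))]
  have hK0 : 0 ≤ Real.log (K₁ : ℝ) := Real.log_natCast_nonneg K₁
  set KA : ℝ := (1 + Real.log K₁) ^ A with hKA
  have hKA1 : 1 ≤ KA := one_le_pow₀ (by linarith)
  have hKA0 : 0 < KA := by linarith
  set T₁ : ℝ := C₁ * D / KA with hT₁
  set T₂ : ℝ := C₂ * D / KA with hT₂
  have hT₁0 : 0 ≤ T₁ := by positivity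
  have hT₂0 : 0 ≤ T₂ := by positivity
  set sq : ℝ := Real.sqrt (2 * α * K₁ * Y) with hsq
  have hsq0 : 0 ≤ sq := Real.sqrt_nonneg _
  -- the sequences
  set b₁ : ℕ → ℝ := fun k ↦ (if k.Coprime n then W k else 0) *
    ∑ x ∈ k.divisorsAntidiagonal, (Real.log x.1 - Real.log x.2) ^ r with hb₁
  set b₂ : ℕ → ℝ := fun k ↦ (if k.Coprime n then W k else 0) *
    ∑ x ∈ k.divisorsAntidiagonal, (Real.log x.1 - Real.log x.2) ^ s with hb₂
  -- tails from «DRTAIL»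
  have htail : ∀ (b : ℕ → ℝ) (c C : ℝ), 0 ≤ C →
      (∀ y : ℝ, 1 ≤ y → |(∑ k ∈ Icc 1 ⌊y⌋₊, b k) - c| ≤ C * D / (1 + Real.log y) ^ A) →
      ∀ e : ℕ, K₁ ≤ e → |∑ k ∈ Icc 1 e, (b k - if k = 1 then c else 0)| ≤ C * D / KA := by
    intro b c C hC hcy e he
    rcases Nat.eq_zero_or_pos e with rfl | he0
    · simp only [show Icc (1 : ℕ) 0 = ∅ from Finset.Icc_eq_empty (by norm_num), Finset.sum_empty, abs_zero]
      positivity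
    · have h1e : 1 ∈ Icc 1 e := Finset.mem_Icc.2 ⟨le_rfl, he0⟩
      have hsum : ∑ k ∈ Icc 1 e, (b k - if k = 1 then c else 0) = (∑ k ∈ Icc 1 e, b k) - c := by
        rw [Finset.sum_sub_distrib, Finset.sum_ite_eq' (Icc 1 e) 1 (fun _ ↦ c), if_pos h1e]
      rw [hsum]
      have h := hcy (e : ℝ) (by exact_mod_cast he0)
      rw [Nat.floor_natCast] at h
      refine h.trans ?_
      apply div_le_div_of_nonneg_left (by positivity) hKA0
      have hle : Real.log (K₁ : ℝ) ≤ Real.log (e : ℝ) := by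
        rcases Nat.eq_zero_or_pos K₁ with rfl | hK
        · simp only [Nat.cast_zero, Real.log_zero]; exact Real.log_natCast_nonneg e
        · exact Real.log_le_log (by exact_mod_cast hK) (by exact_mod_cast he)
      exact pow_le_pow_left₀ (by positivity) (by linarith) A
  have hbt₁ : ∀ e : ℕ, K₁ ≤ e → |∑ k ∈ Icc 1 e, (b₁ k - if k = 1 then c₁ else 0)| ≤ T₁ := htail b₁ c₁ C₁ hC₁ hc₁y
  have hbt₂ : ∀ e : ℕ, K₁ ≤ e → |∑ k ∈ Icc 1 e, (b₂ k - if k = 1 then c₂ else 0)| ≤ T₂ := htail b₂ c₂ C₂ hC₂ hc₂y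
  -- column bound of `b₂` from «DRTAIL» (no log loss)
  have hbcol₂ : ∀ e : ℕ, e ≤ ⌊Y⌋₊ → |∑ k ∈ Icc 1 e, b₂ k| ≤ 2 * (C₂ * D) := by
    intro e _
    rcases Nat.eq_zero_or_pos e with rfl | he0
    · simp only [show Icc (1 : ℕ) 0 = ∅ from Finset.Icc_eq_empty (by norm_num), Finset.sum_empty, abs_zero]
      positivity
    · have h := hc₂y (e : ℝ) (by exact_mod_cast he0)
      rw [Nat.floor_natCast] at h
      have hle : C₂ * D / (1 + Real.log (e : ℝ)) ^ A ≤ C₂ * D :=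
        div_le_self (by positivity) (one_le_pow₀ (by linarith [Real.log_natCast_nonneg e]))
      have : |∑ k ∈ Icc 1 e, b₂ k| ≤ |(∑ k ∈ Icc 1 e, b₂ k) - c₂| + |c₂| := by
        have := abs_add_le ((∑ k ∈ Icc 1 e, b₂ k) - c₂) c₂; simpa using this
      linarith
  -- the abstract δ-subtraction
  have hmain := abs_doubleSum_delta_sub_two_le_pow N (R := R) hR2 b₁ b₂ c₁ c₂ T₁ T₂ (2 * (C₂ * D)) hY hα hi hj hY₁ hbt₁ hbt₂ hbcol₂
  refine hmain.trans ?_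
  -- absolute sums
  have hSb₁ : ∀ m : ℕ, ∑ k ∈ Icc 1 ⌊Y⌋₊, |b₁ k| * ellp Y k ^ m ≤ Real.log Y ^ m * L₁ := fun m ↦
    sum_abs_Wn_logDiff_pow_ellp_pow_le n r m hY
  have hSb₂ : ∀ m : ℕ, ∑ k ∈ Icc 1 ⌊Y⌋₊, |b₂ k| * ellp Y k ^ m ≤ Real.log Y ^ m * L₂ := fun m ↦
    sum_abs_Wn_logDiff_pow_ellp_pow_le n s m hY
  have h1I : 1 ∈ Icc 1 ⌊Y⌋₊ := Finset.mem_Icc.2 ⟨le_rfl, Nat.le_floor (by simpa using hY)⟩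
  have hl1 : ellp Y 1 = Real.log Y := by rw [ellp_eq_log hY0.le h1I]; simp
  have hSbt : ∀ (b : ℕ → ℝ) (c L : ℝ) (m : ℕ), (∑ k ∈ Icc 1 ⌊Y⌋₊, |b k| * ellp Y k ^ m ≤ Real.log Y ^ m * L) →
      ∑ k ∈ Icc 1 ⌊Y⌋₊, |b k - if k = 1 then c else 0| * ellp Y k ^ m ≤ Real.log Y ^ m * (L + |c|) := by
    intro b c L m hSb
    have hpt : ∀ k ∈ Icc 1 ⌊Y⌋₊, |b k - if k = 1 then c else 0| * ellp Y k ^ m ≤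
        |b k| * ellp Y k ^ m + (if k = 1 then |c| * ellp Y k ^ m else 0) := by
      intro k _
      split_ifs with hk
      · have : |b k - c| ≤ |b k| + |c| := abs_sub _ _
        have h0 : 0 ≤ ellp Y k ^ m := pow_nonneg (ellp_nonneg Y k) m
        nlinarith
      · rw [sub_zero]; linarith
    refine (Finset.sum_le_sum hpt).trans ?_
    rw [Finset.sum_add_distrib, Finset.sum_ite_eq' (Icc 1 ⌊Y⌋₊) 1, if_pos h1I, hl1]
    nlinarith [pow_nonneg hLY m, abs_nonneg c]
  have hSδ : ∑ k ∈ Icc 1 ⌊Y⌋₊, |(if k = 1 then (1 : ℝ) else 0)| * ellp Y k ^ i = Real.log Y ^ i := by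
    rw [Finset.sum_eq_single_of_mem 1 h1I (fun k _ hk ↦ by simp [hk])]
    simp [hl1]
  -- `|R α|`
  have hRα : |R α| ≤ C₀ * (sq + x ^ N / KA) := by
    rcases Nat.eq_zero_or_pos K₁ with hK | hK
    · have hK' : (K₁ : ℝ) = 0 := by exact_mod_cast hK
      have hden : KA = 1 := by rw [hKA, hK', Real.log_zero, add_zero, one_pow]
      rw [hden, div_one]
      have hx6 : x ^ M ≤ x ^ N := pow_le_pow_right₀ hx1 hMN
      rcases le_or_gt α 1 with hα1 | hα1
      · have h := hRs α hα hα1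
        calc _ ≤ C₀ * Real.sqrt α := h
          _ ≤ C₀ * 1 := mul_le_mul_of_nonneg_left (Real.sqrt_le_one.2 hα1) hC₀
          _ ≤ C₀ * (sq + x ^ N) := by
              apply mul_le_mul_of_nonneg_left _ hC₀; nlinarith [one_le_pow₀ (M₀ := ℝ) hx1 (n := N)]
      · have h := hRt α hα1.le
        have hlx : 1 + Real.log α ≤ x := by
          rw [hx]
          have hlog : Real.log (2 * α * Y ^ 2) = Real.log 2 + Real.log α + 2 * Real.log Y := by
            rw [Real.log_mul (by positivity) (by positivity), Real.log_mul (by norm_num) hα.ne', Real.log_pow]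
            push_cast; ring
          have hl2 : 0 < Real.log 2 := Real.log_pos (by norm_num)
          have : Real.log α ≤ |Real.log (2 * α * Y ^ 2)| := by
            rw [hlog]; exact le_trans (by linarith) (le_abs_self _)
          linarith
        have hla1 : 0 ≤ 1 + Real.log α := by linarith [Real.log_nonneg hα1.le]
        have hpowM : (1 + Real.log α) ^ M ≤ x ^ M := pow_le_pow_left₀ hla1 hlx M
        calc _ ≤ C₀ * (1 + Real.log α) ^ M := h
          _ ≤ C₀ * x ^ N := mul_le_mul_of_nonneg_left (hpowM.trans hx6) hC₀
          _ ≤ C₀ * (sq + x ^ N) := by apply mul_le_mul_of_nonneg_left _ hC₀; linarith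
    · have hK1 : (1 : ℝ) ≤ K₁ := by exact_mod_cast hK
      have hαle : α ≤ 2 * α * K₁ * Y := by
        have h2 : (1 : ℝ) ≤ 2 * K₁ * Y := by nlinarith
        have := mul_le_mul_of_nonneg_left h2 hα.le
        linarith
      have hα1 : α ≤ 1 := hαle.trans hY₁
      have h := hRs α hα hα1
      calc _ ≤ C₀ * Real.sqrt α := h
        _ ≤ C₀ * sq := mul_le_mul_of_nonneg_left (Real.sqrt_le_sqrt hαle) hC₀
        _ ≤ C₀ * (sq + x ^ N / KA) := by
            apply mul_le_mul_of_nonneg_left _ hC₀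
            have : 0 ≤ x ^ N / KA := by positivity
            linarith
  -- bookkeeping
  have hLi : 0 ≤ Real.log Y ^ i := pow_nonneg hLY i
  have hLj : 0 ≤ Real.log Y ^ j := pow_nonneg hLY j
  set CD₁ : ℝ := C₁ * D with hCD₁
  set CD₂ : ℝ := C₂ * D with hCD₂
  have hCD₁0 : 0 ≤ CD₁ := by positivity
  have hCD₂0 : 0 ≤ CD₂ := by positivity
  have hc₁' : |c₁| ≤ CD₁ := hc₁
  have hc₂' : |c₂| ≤ CD₂ := hc₂
  have hx6 : 0 ≤ x ^ N := by positivity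
  have hT₁def : T₁ = CD₁ / KA := by rw [hT₁, hCD₁]
  have hT₂def : T₂ = CD₂ / KA := by rw [hT₂, hCD₂]
  have t1 : (∑ k ∈ Icc 1 ⌊Y⌋₊, |b₁ k - if k = 1 then c₁ else 0| * ellp Y k ^ i) *
      ((2 * (C₂ * D)) * (Real.log Y ^ j * (3 * C₀ * sq))) ≤ Real.log Y ^ (i + j) * (C₀ * (6 * CD₂ * (L₁ + CD₁) * sq)) := by
    have hX : 0 ≤ (2 * (C₂ * D)) * (Real.log Y ^ j * (3 * C₀ * sq)) := by positivity
    have hS := hSbt b₁ c₁ L₁ i (hSb₁ i)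
    calc _ ≤ (Real.log Y ^ i * (L₁ + |c₁|)) * ((2 * (C₂ * D)) * (Real.log Y ^ j * (3 * C₀ * sq))) :=
          mul_le_mul_of_nonneg_right hS hX
      _ ≤ (Real.log Y ^ i * (L₁ + CD₁)) * ((2 * (C₂ * D)) * (Real.log Y ^ j * (3 * C₀ * sq))) := by
          gcongr
      _ = _ := by rw [pow_add, hCD₂]; ring
  have t2 : (∑ k ∈ Icc 1 ⌊Y⌋₊, |b₂ k| * ellp Y k ^ j) * ((2 * T₁) * (Real.log Y ^ i * (9 * C₀ * x ^ N))) ≤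
      Real.log Y ^ (i + j) * (C₀ * (18 * L₂ * CD₁ * x ^ N / KA)) := by
    have hX : 0 ≤ (2 * T₁) * (Real.log Y ^ i * (9 * C₀ * x ^ N)) := by positivity
    calc _ ≤ (Real.log Y ^ j * L₂) * ((2 * T₁) * (Real.log Y ^ i * (9 * C₀ * x ^ N))) :=
          mul_le_mul_of_nonneg_right (hSb₂ j) hX
      _ = _ := by rw [pow_add, hT₁def]; field_simp; ring
  have t3 : |c₁| * ((∑ k ∈ Icc 1 ⌊Y⌋₊, |b₂ k - if k = 1 then c₂ else 0| * ellp Y k ^ j) *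
      (1 * (Real.log Y ^ i * (3 * C₀ * sq)))) ≤ Real.log Y ^ (i + j) * (C₀ * (3 * CD₁ * (L₂ + CD₂) * sq)) := by
    have hX : 0 ≤ 1 * (Real.log Y ^ i * (3 * C₀ * sq)) := by positivity
    have hS := hSbt b₂ c₂ L₂ j (hSb₂ j)
    calc _ ≤ |c₁| * ((Real.log Y ^ j * (L₂ + |c₂|)) * (1 * (Real.log Y ^ i * (3 * C₀ * sq)))) :=
          mul_le_mul_of_nonneg_left (mul_le_mul_of_nonneg_right hS hX) (abs_nonneg _)
      _ ≤ CD₁ * ((Real.log Y ^ j * (L₂ + CD₂)) * (1 * (Real.log Y ^ i * (3 * C₀ * sq)))) := by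
          gcongr
      _ = _ := by rw [pow_add]; ring
  have t4 : |c₁| * ((∑ k ∈ Icc 1 ⌊Y⌋₊, |(if k = 1 then (1 : ℝ) else 0)| * ellp Y k ^ i) *
      ((2 * T₂) * (Real.log Y ^ j * (9 * C₀ * x ^ N)))) ≤
      Real.log Y ^ (i + j) * (C₀ * (18 * (CD₁ * CD₂) * x ^ N / KA)) := by
    rw [hSδ]
    have hX : 0 ≤ Real.log Y ^ i * ((2 * T₂) * (Real.log Y ^ j * (9 * C₀ * x ^ N))) := by positivity
    calc _ ≤ CD₁ * (Real.log Y ^ i * ((2 * T₂) * (Real.log Y ^ j * (9 * C₀ * x ^ N)))) :=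
          mul_le_mul_of_nonneg_right hc₁' hX
      _ = _ := by rw [pow_add, hT₂def]; field_simp; ring
  have t5 : |c₁| * |c₂| * Real.log Y ^ i * Real.log Y ^ j * |R α| ≤
      Real.log Y ^ (i + j) * (C₀ * ((CD₁ * CD₂) * (sq + x ^ N / KA))) := by
    have h12 : |c₁| * |c₂| ≤ CD₁ * CD₂ := mul_le_mul hc₁' hc₂' (abs_nonneg _) hCD₁0
    calc _ ≤ CD₁ * CD₂ * Real.log Y ^ i * Real.log Y ^ j * (C₀ * (sq + x ^ N / KA)) :=
          mul_le_mul (mul_le_mul_of_nonneg_right (mul_le_mul_of_nonneg_right h12 hLi) hLj) hRα (abs_nonneg _)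
            (by positivity)
      _ = _ := by rw [pow_add]; ring
  rw [hl1]
  have hsum := add_le_add (add_le_add (add_le_add t1 t2) (add_le_add t3 t4)) t5
  refine le_trans (le_of_eq ?_) (hsum.trans (le_of_eq ?_))
  · ring
  · rw [hCD₁, hCD₂]; field_simp; ring


set_option maxHeartbeats 1600000 in
/-- **The generic one-sided moment monomial, PARAMETRIC form** (row-saving constant `C_a` and tail constant `C₂` as inputs).
[cite: KowalskiMichelVanderKam2000, Prop. 5.1 — derivation (one-sided decorated remainder monomial)] -/
theorem abs_onesided_moments_le_pow_of (s A N : ℕ) {Ca C₂ : ℝ} (hCa : 0 < Ca) (hC₂ : 0 ≤ C₂)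
    (ha : ∀ n : ℕ, n ≠ 0 → ∀ y : ℝ, 1 ≤ y → |∑ k ∈ Icc 1 ⌊y⌋₊, copTauW n k| ≤ Ca * divWeight n / (1 + Real.log y) ^ A)
    (h₂ : ∀ n : ℕ, n ≠ 0 → ∃ c : ℝ, |c| ≤ C₂ * divWeight n ∧ ∀ y : ℝ, 1 ≤ y →
      |(∑ k ∈ Icc 1 ⌊y⌋₊, (if k.Coprime n then W k else 0) *
          ∑ z ∈ k.divisorsAntidiagonal, (Real.log z.1 - Real.log z.2) ^ s) - c| ≤ C₂ * divWeight n / (1 + Real.log y) ^ A)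
    {R : ℝ → ℝ} {C₀ : ℝ} (hC₀ : 0 ≤ C₀)
    (hR2 : ∀ (a₁ a₂ : ℕ → ℝ) (Y α B η : ℝ) (K₁ i j : ℕ), 1 ≤ Y → 0 < α → 1 ≤ i → 1 ≤ j →
      (∀ e : ℕ, e ≤ ⌊Y⌋₊ → |∑ k ∈ Icc 1 e, a₂ k| ≤ B) → (∀ e : ℕ, K₁ ≤ e → |∑ k ∈ Icc 1 e, a₁ k| ≤ η) →
      2 * α * K₁ * Y ≤ 1 →
    |∑ k₁ ∈ Icc 1 ⌊Y⌋₊, ∑ k₂ ∈ Icc 1 ⌊Y⌋₊,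
        a₁ k₁ * a₂ k₂ * ellp Y k₁ ^ i * ellp Y k₂ ^ j * R (α * k₁ * k₂)| ≤
      (∑ k ∈ Icc 1 ⌊Y⌋₊, |a₁ k| * ellp Y k ^ i) * (B * (Real.log Y ^ j * (3 * C₀ * Real.sqrt (2 * α * K₁ * Y)))) +
        (∑ k ∈ Icc 1 ⌊Y⌋₊, |a₂ k| * ellp Y k ^ j) *
          ((2 * η) * (Real.log Y ^ i * (9 * C₀ * (1 + |Real.log (2 * α * Y ^ 2)|) ^ N)))) :
    ∀ n : ℕ, n ≠ 0 → ∀ (Y α : ℝ) (K₁ i j : ℕ), 1 ≤ Y → 0 < α → 1 ≤ i → 1 ≤ j → 2 * α * K₁ * Y ≤ 1 →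
    |∑ k₁ ∈ Icc 1 ⌊Y⌋₊, ∑ k₂ ∈ Icc 1 ⌊Y⌋₊,
        copTauW n k₁ *
          ((if k₂.Coprime n then W k₂ else 0) * ∑ x ∈ k₂.divisorsAntidiagonal, (Real.log x.1 - Real.log x.2) ^ s) *
            ellp Y k₁ ^ i * ellp Y k₂ ^ j * R (α * k₁ * k₂)| ≤
      Real.log Y ^ (i + j) * (C₀ *
        (6 * (C₂ * divWeight n) * (1 + Real.log Y) ^ 2 * Real.sqrt (2 * α * K₁ * Y) +
          18 * (1 + Real.log Y) ^ (s + 2) * (Ca * divWeight n) *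
            (1 + |Real.log (2 * α * Y ^ 2)|) ^ N / (1 + Real.log K₁) ^ A)) := by
  intro n hn Y α K₁ i j hY hα hi hj hY₁
  obtain ⟨c₂, hc₂, hc₂y⟩ := h₂ n hn
  set D : ℝ := divWeight n with hDdef
  have hD0 : 0 ≤ D := divWeight_nonneg n
  have hY0 : 0 < Y := by linarith
  have hLY : 0 ≤ Real.log Y := Real.log_nonneg hY
  have hK0 : 0 ≤ Real.log (K₁ : ℝ) := Real.log_natCast_nonneg K₁
  set KA : ℝ := (1 + Real.log K₁) ^ A with hKA
  have hKA0 : 0 < KA := by positivity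
  set b₂ : ℕ → ℝ := fun k ↦ (if k.Coprime n then W k else 0) *
    ∑ x ∈ k.divisorsAntidiagonal, (Real.log x.1 - Real.log x.2) ^ s with hb₂
  -- tail of the row `a_n` beyond `K₁`
  have hat : ∀ e : ℕ, K₁ ≤ e → |∑ k ∈ Icc 1 e, copTauW n k| ≤ Ca * D / KA := by
    intro e he
    rcases Nat.eq_zero_or_pos e with rfl | he0
    · simp only [show Icc (1 : ℕ) 0 = ∅ from Finset.Icc_eq_empty (by norm_num), Finset.sum_empty, abs_zero]
      positivity
    · have h := ha n hn (e : ℝ) (by exact_mod_cast he0)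
      rw [Nat.floor_natCast] at h
      refine h.trans ?_
      apply div_le_div_of_nonneg_left (by positivity) hKA0
      have hle : Real.log (K₁ : ℝ) ≤ Real.log (e : ℝ) := by
        rcases Nat.eq_zero_or_pos K₁ with rfl | hK
        · simp only [Nat.cast_zero, Real.log_zero]; exact Real.log_natCast_nonneg e
        · exact Real.log_le_log (by exact_mod_cast hK) (by exact_mod_cast he)
      exact pow_le_pow_left₀ (by positivity) (by linarith) A
  -- column bound of `b₂` from «DRTAIL»
  have hbcol₂ : ∀ e : ℕ, e ≤ ⌊Y⌋₊ → |∑ k ∈ Icc 1 e, b₂ k| ≤ 2 * (C₂ * D) := by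
    intro e _
    rcases Nat.eq_zero_or_pos e with rfl | he0
    · simp only [show Icc (1 : ℕ) 0 = ∅ from Finset.Icc_eq_empty (by norm_num), Finset.sum_empty, abs_zero]
      positivity
    · have h := hc₂y (e : ℝ) (by exact_mod_cast he0)
      rw [Nat.floor_natCast] at h
      have hle : C₂ * D / (1 + Real.log (e : ℝ)) ^ A ≤ C₂ * D :=
        div_le_self (by positivity) (one_le_pow₀ (by linarith [Real.log_natCast_nonneg e]))
      have : |∑ k ∈ Icc 1 e, b₂ k| ≤ |(∑ k ∈ Icc 1 e, b₂ k) - c₂| + |c₂| := by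
        have := abs_add_le ((∑ k ∈ Icc 1 e, b₂ k) - c₂) c₂; simpa using this
      linarith
  have hmain := hR2 (fun k ↦ copTauW n k) b₂ Y α (2 * (C₂ * D)) (Ca * D / KA) K₁ i j hY hα hi hj hbcol₂ hat hY₁
  refine hmain.trans ?_
  have hSa : ∑ k ∈ Icc 1 ⌊Y⌋₊, |copTauW n k| * ellp Y k ^ i ≤ Real.log Y ^ i * (1 + Real.log Y) ^ 2 :=
    sum_abs_copTauW_mul_ellp_pow_le n i hY
  have hSb : ∑ k ∈ Icc 1 ⌊Y⌋₊, |b₂ k| * ellp Y k ^ j ≤ Real.log Y ^ j * (1 + Real.log Y) ^ (s + 2) :=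
    sum_abs_Wn_logDiff_pow_ellp_pow_le n s j hY
  set sq : ℝ := Real.sqrt (2 * α * K₁ * Y) with hsq
  set x : ℝ := 1 + |Real.log (2 * α * Y ^ 2)| with hx
  have t1 : (∑ k ∈ Icc 1 ⌊Y⌋₊, |copTauW n k| * ellp Y k ^ i) * ((2 * (C₂ * D)) * (Real.log Y ^ j * (3 * C₀ * sq))) ≤
      Real.log Y ^ (i + j) * (C₀ * (6 * (C₂ * D) * (1 + Real.log Y) ^ 2 * sq)) := by
    have hX : 0 ≤ (2 * (C₂ * D)) * (Real.log Y ^ j * (3 * C₀ * sq)) := by positivity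
    calc _ ≤ (Real.log Y ^ i * (1 + Real.log Y) ^ 2) * ((2 * (C₂ * D)) * (Real.log Y ^ j * (3 * C₀ * sq))) :=
          mul_le_mul_of_nonneg_right hSa hX
      _ = _ := by rw [pow_add]; ring
  have t2 : (∑ k ∈ Icc 1 ⌊Y⌋₊, |b₂ k| * ellp Y k ^ j) * ((2 * (Ca * D / KA)) * (Real.log Y ^ i * (9 * C₀ * x ^ N))) ≤
      Real.log Y ^ (i + j) * (C₀ * (18 * (1 + Real.log Y) ^ (s + 2) * (Ca * D) * x ^ N / KA)) := by
    have hX : 0 ≤ (2 * (Ca * D / KA)) * (Real.log Y ^ i * (9 * C₀ * x ^ N)) := by positivity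
    calc _ ≤ (Real.log Y ^ j * (1 + Real.log Y) ^ (s + 2)) * ((2 * (Ca * D / KA)) * (Real.log Y ^ i * (9 * C₀ * x ^ N))) :=
          mul_le_mul_of_nonneg_right hSb hX
      _ = _ := by rw [pow_add]; field_simp; ring
  refine (add_le_add t1 t2).trans (le_of_eq ?_)
  rw [mul_div_assoc]
  ring

end Summit.Parity.GeneralizedHardyLittlewood.Theorems.MomentsBeyondDiagonal.DiagCorner

end
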